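import Summits.CriticalPhenomena.PercolationContinuityZ3.Theorems.FK.MagnetizationFieldDerivative
import HarnessLib

/-!
# EXPONENTIAL DECAY OF THE TRUNCATED TWO-POINT FUNCTION IN A NONNEGATIVE FIELD, AND THE SUSCEPTIBILITY IS MAXIMAL AT
# ZERO FIELD: `⟨σ_0;σ_z⟩⁺_{β,h} ≤ ⟨σ_0;σ_z⟩⁺_{β,0}`, `σ²(β,h) ≤ χ(β)` (GHS; Ellis 2006, Lemma V.7.3 (b) and Thm. V.7.7)

Claimed R42 (8)(c) in the cell INBOX at 2026-08-28T21:27:52Z by fkp-10a gen 356 (NEW CLAIM #1 of the gen), addressed to coordinator fk-4 (next seated gen; (ι) in force for windows); lineage row FO-10a-g356 (self-suggested), package g356-susceptibility, label FR-E.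
Helper file of the `fk-continuity` build cell (bschramm lane; `--supports stmt-CriticalPhenomena-4575`); builds on
p205010 (kernel theorem, internal audit signed; external expert review pending). No definitions, no named facts, no
sorries; standard axioms. UNCONDITIONAL (nearest-neighbour Ising model on `ℤ^d`, `d ≥ 2`).

By the GHS monotonicity in the field (Ellis V.7.3 (b), `plusTruncated_antitoneOn_field`) the truncated plus two-point
function at `h ≥ 0` is dominated by its zero-field value; the tree's decay theorems at `h = 0` then give, uniformly in
the field `h ≥ 0`:

* `plusTruncated_le_twoPointFree` — for `β ≤ β_c`: `u(z;h) ≤ ⟨σ_0σ_z⟩_{β}` (zero-field two-point function);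
* **`exists_exp_decay_plusTruncated_of_lt_criticalBeta`** — for `0 ≤ β < β_c`: `0 ≤ u(z;h) ≤ e^{−c‖z‖}` for ALL `h ≥ 0`
  with ONE rate `c = c(β) > 0` (sharpness, Aizenman–Barsky–Fernández / Duminil-Copin–Tassion, the tree's PROVED
  `twoPoint_exponentialDecay_of_lt_criticalBeta_holds`) — Ellis Thm. V.7.7 ("decays exponentially for `β > 0, h ≠ 0`")
  in the high-temperature regime, by correlation inequalities instead of Lebowitz–Penrose analyticity;
* **`tsum_plusTruncated_le_susceptibility`** — `σ²(β,h) ≤ χ(β)` for all `h ≥ 0`, `β < β_c`: the fluctuations of the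
  magnetisation are largest at zero field; with the fluctuation–response theorem, `∂⁺m/∂h (β,h) ≤ β χ(β)`
  (`rightDeriv_magnetizationInField_le`);
* **`plusTruncated_le_exp_of_ltBeta_le`** — for `β ≥ ltBeta d` (low temperature): `0 ≤ u(z;h) ≤ e^{−(β/2)‖z‖}` for all
  `h ≥ 0` (the tree's Peierls–contour bound `LTContour.plusCorr_truncated_le_exp`, Friedli–Velenik Thm. 5.16, pushed to
  positive fields), `summable_plusTruncated_of_ltBeta_le_of_nonneg`, and hence
  **`hasDerivWithinAt_magnetizationInField_zero_of_ltBeta_le`**: the LOW-TEMPERATURE INITIAL SUSCEPTIBILITY IS FINITE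
  and `∂⁺m/∂h (β, 0) = β χ⁺(β) = β Σ_z ⟨σ_0;σ_z⟩⁺_{β,0}` (Ellis V.7.4 at `h = 0⁺`, `β ≥ ltBeta d`).

## References

* R. S. Ellis, *Entropy, Large Deviations, and Statistical Mechanics*, Springer (1985/2006), Lemma V.7.3 (b),
  Lemma V.7.4, Thm. V.7.7. [Ellis2006]
* J. L. Lebowitz, Comm. Math. Phys. 35 (1974) 87–92, Remark (ii). [Lebowitz1974]
* M. Aizenman, D. J. Barsky, R. Fernández, J. Stat. Phys. 47 (1987) 343–374, Thm. 1. [AizenmanBarskyFernandezJSP1987]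
* S. Friedli, Y. Velenik, *Statistical Mechanics of Lattice Systems*, CUP (2017), Thm. 3.25, Thm. 5.16. [FriedliVelenik2017]
-/

noncomputable section

namespace Summit.CriticalPhenomena.PercolationContinuityZ3.Theorems.FK

namespace IsingSusceptibility

open MeasureTheory Filter Topology Finset Set
open scoped symmDiff
open Literature.Probability.LatticeModels
open Summit.CriticalPhenomena.PercolationContinuityZ3.Theorems.FK.IsingCLT

variable {d : ℕ}

/-- **GHS domination by the zero-field value**: for `β ≥ 0`, `h ≥ 0`, `u(z;h) ≤ u(z;0)`. [cite: Ellis2006, Lemma V.7.3 (b), eq. (5.27)] -/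
theorem plusTruncated_le_zero_field {β : ℝ} (hβ : 0 ≤ β) {h : ℝ} (hh : 0 ≤ h) (z : Site d) :
    plusCorr d β h ({0} ∆ {z}) - plusCorr d β h {0} * plusCorr d β h {z} ≤
      plusCorr d β 0 ({0} ∆ {z}) - plusCorr d β 0 {0} * plusCorr d β 0 {z} :=
  plusTruncated_antitoneOn_field hβ 0 z (mem_Ici.2 le_rfl) (mem_Ici.2 hh) hh

/-- **`u(z;h) ≤ ⟨σ_0σ_z⟩_β` for `β ≤ β_c`, `h ≥ 0`** (`d ≥ 2`): at zero field `m* = 0` and the plus and free states agree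
up to `β_c`. [cite: Ellis2006, Lemma V.7.3 (b); FriedliVelenik2017, Thm. 3.25] -/
theorem plusTruncated_le_twoPointFree (hd : 2 ≤ d) {β : ℝ} (hβ : 0 ≤ β) (hβc : β ≤ criticalBeta d) {h : ℝ}
    (hh : 0 ≤ h) (z : Site d) :
    plusCorr d β h ({0} ∆ {z}) - plusCorr d β h {0} * plusCorr d β h {z} ≤ twoPointFree d β z := by
  rw [← plusTruncated_zero_field_eq_twoPointFree hd hβ hβc z]
  exact plusTruncated_le_zero_field hβ hh z

/-- **EXPONENTIAL DECAY OF `⟨σ_0;σ_z⟩⁺_{β,h}` UNIFORMLY IN `h ≥ 0`, HIGH TEMPERATURE** (`d ≥ 2`, `0 ≤ β < β_c`): there is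
`c > 0` with `0 ≤ ⟨σ_{{0}∆{z}}⟩⁺_{β,h} − ⟨σ_0⟩⁺_{β,h}⟨σ_z⟩⁺_{β,h} ≤ e^{−c‖z‖}` for every `h ≥ 0` and `z ∈ ℤ^d`
(GHS domination + the tree's sharpness theorem `twoPoint_exponentialDecay_of_lt_criticalBeta_holds`).
[cite: Ellis2006, Thm. V.7.7; AizenmanBarskyFernandezJSP1987, Thm. 1; Lebowitz1974, Remark (ii)] -/
theorem exists_exp_decay_plusTruncated_of_lt_criticalBeta (hd : 2 ≤ d) {β : ℝ} (hβ : 0 ≤ β)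
    (hβc : β < criticalBeta d) :
    ∃ c : ℝ, 0 < c ∧ ∀ h : ℝ, 0 ≤ h → ∀ z : Site d,
      0 ≤ plusCorr d β h ({0} ∆ {z}) - plusCorr d β h {0} * plusCorr d β h {z} ∧
        plusCorr d β h ({0} ∆ {z}) - plusCorr d β h {0} * plusCorr d β h {z} ≤ Real.exp (-c * ‖z‖) := by
  obtain ⟨c, hc, hdec⟩ := twoPoint_exponentialDecay_of_lt_criticalBeta_holds (d := d) hd hβ hβc
  exact ⟨c, hc, fun h hh z => ⟨plusTruncated_nonneg hβ h 0 z,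
    (plusTruncated_le_twoPointFree hd hβ hβc.le hh z).trans (hdec z)⟩⟩

/-- `σ²(β,h)` converges for every `h ≥ 0` when `0 ≤ β < β_c` (`d ≥ 2`), by domination. [cite: Ellis2006, Thm. V.7.7] -/
theorem summable_plusTruncated_of_lt_criticalBeta (hd : 2 ≤ d) {β : ℝ} (hβ : 0 ≤ β) (hβc : β < criticalBeta d)
    {h : ℝ} (hh : 0 ≤ h) :
    Summable fun z : Site d => plusCorr d β h ({0} ∆ {z}) - plusCorr d β h {0} * plusCorr d β h {z} :=
  (summable_twoPointFree_of_lt_criticalBeta hd hβ hβc).of_nonneg_of_le (fun z => plusTruncated_nonneg hβ h 0 z)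
    fun z => plusTruncated_le_twoPointFree hd hβ hβc.le hh z

/-- **THE SUSCEPTIBILITY IS MAXIMAL AT ZERO FIELD**: `σ²(β,h) = Σ_z ⟨σ_0;σ_z⟩⁺_{β,h} ≤ χ(β)` for every `h ≥ 0`,
`0 ≤ β < β_c`, `d ≥ 2` (`χ(β) = (susceptibility d β).toReal`). [cite: Ellis2006, Lemma V.7.3 (b); FriedliVelenik2017, eq. (3.67)] -/
theorem tsum_plusTruncated_le_susceptibility (hd : 2 ≤ d) {β : ℝ} (hβ : 0 ≤ β) (hβc : β < criticalBeta d) {h : ℝ}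
    (hh : 0 ≤ h) :
    ∑' z : Site d, (plusCorr d β h ({0} ∆ {z}) - plusCorr d β h {0} * plusCorr d β h {z}) ≤
      (susceptibility d β).toReal := by
  rw [← tsum_twoPointFree_eq_toReal_susceptibility hβ (summable_twoPointFree_of_lt_criticalBeta hd hβ hβc)]
  exact (summable_plusTruncated_of_lt_criticalBeta hd hβ hβc hh).tsum_le_tsum
    (fun z => plusTruncated_le_twoPointFree hd hβ hβc.le hh z) (summable_twoPointFree_of_lt_criticalBeta hd hβ hβc)

/-- **`∂⁺m/∂h (β,h) ≤ β χ(β)` for every `h ≥ 0`** (`0 < β < β_c`, `d ≥ 2`): the response to the field is largest at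
zero field. [cite: Ellis2006, Lemma V.7.4 with Lemma V.7.3 (b)] -/
theorem rightDeriv_magnetizationInField_le (hd : 2 ≤ d) {β : ℝ} (hβ : 0 < β) (hβc : β < criticalBeta d) {h : ℝ}
    (hh : 0 ≤ h) :
    ∃ D : ℝ, HasDerivWithinAt (fun t => magnetizationInField d β t) D (Ici h) h ∧
      D ≤ β * (susceptibility d β).toReal :=
  ⟨_, hasDerivWithinAt_magnetizationInField_Ici hβ hh (summable_plusTruncated_of_lt_criticalBeta hd hβ.le hβc hh),
    mul_le_mul_of_nonneg_left (tsum_plusTruncated_le_susceptibility hd hβ.le hβc hh) hβ.le⟩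

/-! ### Low temperature: `β ≥ ltBeta d` -/

/-- **EXPONENTIAL DECAY OF `⟨σ_0;σ_z⟩⁺_{β,h}` UNIFORMLY IN `h ≥ 0`, LOW TEMPERATURE** (`d ≥ 2`, `β ≥ ltBeta d`):
`0 ≤ u(z;h) ≤ e^{−(β/2)‖z‖}` (GHS domination + the tree's contour bound `LTContour.plusCorr_truncated_le_exp`,
Friedli–Velenik Thm. 5.16). [cite: FriedliVelenik2017, Thm. 5.16; Ellis2006, Lemma V.7.3 (b)] -/
theorem plusTruncated_le_exp_of_ltBeta_le (hd : 2 ≤ d) {β : ℝ} (hβ : LTContour.ltBeta d ≤ β) {h : ℝ} (hh : 0 ≤ h)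
    (z : Site d) :
    0 ≤ plusCorr d β h ({0} ∆ {z}) - plusCorr d β h {0} * plusCorr d β h {z} ∧
      plusCorr d β h ({0} ∆ {z}) - plusCorr d β h {0} * plusCorr d β h {z} ≤ Real.exp (-(β / 2 * ‖(0 : Site d) - z‖)) := by
  haveI : NeZero d := ⟨by omega⟩
  have hβ0 : 0 ≤ β := by have := LTContour.one_le_ltBeta d; linarith
  exact ⟨plusTruncated_nonneg hβ0 h 0 z,
    (plusTruncated_le_zero_field hβ0 hh z).trans (LTContour.plusCorr_truncated_le_exp hd hβ 0 z).2⟩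

/-- `σ²(β,h)` converges for every `h ≥ 0` when `β ≥ ltBeta d` (`d ≥ 2`). [cite: FriedliVelenik2017, Thm. 5.16] -/
theorem summable_plusTruncated_of_ltBeta_le_of_nonneg (hd : 2 ≤ d) {β : ℝ} (hβ : LTContour.ltBeta d ≤ β) {h : ℝ}
    (hh : 0 ≤ h) :
    Summable fun z : Site d => plusCorr d β h ({0} ∆ {z}) - plusCorr d β h {0} * plusCorr d β h {z} := by
  have hβ0 : 0 ≤ β := by have := LTContour.one_le_ltBeta d; linarith
  exact (summable_plusTruncated_of_ltBeta_le hd hβ).of_nonneg_of_le (fun z => plusTruncated_nonneg hβ0 h 0 z)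
    fun z => plusTruncated_le_zero_field hβ0 hh z

/-- **THE LOW-TEMPERATURE INITIAL SUSCEPTIBILITY: `∂⁺m/∂h (β,0) = β χ⁺(β) = β Σ_z ⟨σ_0;σ_z⟩⁺_{β,0} < ∞`** for `d ≥ 2`,
`β ≥ ltBeta d` — the magnetisation leaves `m*(β)` with the FINITE slope `β χ⁺(β)` (Ellis Lemma V.7.4 at `h = 0⁺` in
the plus phase). [cite: Ellis2006, Lemma V.7.4; FriedliVelenik2017, Thm. 5.16] -/
theorem hasDerivWithinAt_magnetizationInField_zero_of_ltBeta_le (hd : 2 ≤ d) {β : ℝ} (hβ : LTContour.ltBeta d ≤ β) :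
    HasDerivWithinAt (fun t => magnetizationInField d β t)
      (β * ∑' z : Site d, (plusCorr d β 0 ({0} ∆ {z}) - plusCorr d β 0 {0} * plusCorr d β 0 {z})) (Ici 0) 0 := by
  have hβ0 : 0 < β := by have := LTContour.one_le_ltBeta d; linarith
  exact hasDerivWithinAt_magnetizationInField_Ici hβ0 le_rfl (summable_plusTruncated_of_ltBeta_le hd hβ)

/-- The low-temperature magnetisation in a field lies below its tangent at `h = 0`:
`m(β,h) ≤ m*(β) + β χ⁺(β) h` (`β ≥ ltBeta d`, `h ≥ 0`, `d ≥ 2`). [cite: Ellis2006, Lemma V.7.4] -/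
theorem magnetizationInField_le_spontaneousMagnetization_add (hd : 2 ≤ d) {β : ℝ} (hβ : LTContour.ltBeta d ≤ β)
    {h : ℝ} (hh : 0 ≤ h) :
    magnetizationInField d β h ≤ spontaneousMagnetization d β +
      β * (∑' z : Site d, (plusCorr d β 0 ({0} ∆ {z}) - plusCorr d β 0 {0} * plusCorr d β 0 {z})) * h := by
  have hβ0 : 0 < β := by have := LTContour.one_le_ltBeta d; linarith
  have := magnetizationInField_le_add_mul hβ0 le_rfl hh (summable_plusTruncated_of_ltBeta_le hd hβ)
  rw [sub_zero, magnetizationInField_zero] at this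
  exact this

end IsingSusceptibility

end Summit.CriticalPhenomena.PercolationContinuityZ3.Theorems.FK

end
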